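import Mathlib
import Summits.Ventures.PercRepro2.Defs
import Summits.Ventures.PercRepro2.Harris
import Summits.Ventures.PercRepro2.CoinDefs
import Summits.Ventures.PercRepro2.CoinArcsOff
import Summits.Ventures.PercRepro2.CoinSinkAlg
import Summits.Ventures.PercRepro2.CoinSink
import Summits.Ventures.PercRepro2.CoinPendantDefs
import Summits.Ventures.PercRepro2.CoinPendant
import Summits.Ventures.PercRepro2.CoinChain
import Summits.Ventures.PercRepro2.CoinPathDefs
import Summits.Ventures.PercRepro2.CoinPathAlg
import Summits.Ventures.PercRepro2.CoinPath
import Summits.Ventures.PercRepro2.CoinInduced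
import Summits.Ventures.PercRepro2.CoinFrontier
import Summits.Ventures.PercRepro2.CoinVdBK

/-!
# Row 2′DARC on MIXED coin systems: the sink, pendant and path theorems UNCONDITIONAL (blind cell
PercRepro2, night-2)

`CoinSink.lean`, `CoinPendant.lean` and `CoinPath.lean` prove the gate statement
`DARC p arcs s T a b u w` (`Φ_D({s ↛ T in D + (u → w)}) ≥ 0`, row 2′DARC) from four / six
directed-BHK facts on the reduced system `D₀ = arcsOff arcs Z`: conditional covariances `≥ 0` on
avoidance events (`covC`) and the monotonicity of the conditional means in the avoided set.  With
the directed van den Berg–Kahn inequality of `CoinVdBK.lean` (`covC_nonneg`,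
`shift_avoid_more_C`) these facts hold on every `SameEnds` coin system — single arcs and
antiparallel pairs, the MIXED systems of row 2′DARC (NEG-80) — and `SameEnds` is hereditary under
`arcsOff`.  Hence the three theorems hold UNCONDITIONALLY on mixed coin systems; what remains as
hypotheses is the structural shape (sink into `T` / pendant forward closure / pendant path) and
the non-degeneracy of the reduced avoidance events (positive probability — the cleared forms
divide by them).

* `darc_of_sink_mixed` — the head `w ∉ T` of the arc has all its out-arcs into `T`
  (NIGHT2-DARC.md §8);
* `darc_of_pendant_mixed` — the forward closure `Z'` of `w` is entered only at `w`
  (NIGHT2-DARC.md §11);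
* `darc_of_path_mixed` — the pendant path `w → v → t` with arbitrary single-arc entries into `v`
  (the chain lemma, NIGHT2-DARC.md §12).
-/

namespace Summit.Ventures.PercRepro2.Coin

section Hereditary

variable {V : Type*} {E : Type*} [DecidableEq V]

/-- `SameEnds` is hereditary: deleting arcs (`arcsOff`) keeps it. -/
lemma sameEnds_arcsOff {arcs : E → Finset (V × V)} (hS : SameEnds arcs) (Z : Finset V) :
    SameEnds (arcsOff arcs Z) := by
  intro e xy hxy x'y' hx'y'
  simp only [arcsOff, Finset.mem_filter] at hxy hx'y'
  exact hS e xy hxy.1 x'y' hx'y'.1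

end Hereditary

section Unconditional

open Classical

variable {V : Type*} {E : Type*} [Fintype V] [DecidableEq V] [Fintype E] [DecidableEq E]
  {R : Type*} [Field R] [LinearOrder R] [IsStrictOrderedRing R]

/-- **THEOREM (sink into `T`, mixed coin systems).** If `w ∉ T` and every out-arc of `w` lands in
`T` (out-coins with tails in `T ∪ {w}` only), then for every `u` the gate statement of the arc
`u → w` holds: `DARC p arcs s T a b u w`, i.e. `Φ_D({s ↛ T in D + (u → w)}) ≥ 0` — on every
`SameEnds` (mixed) coin system, given only the non-degeneracy of the three reduced avoidance
events. -/
theorem darc_of_sink_mixed (p : E → R) (hp : IsProbVec p) {arcs : E → Finset (V × V)}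
    (hS : SameEnds arcs) (s : V) (T : Finset V) (a b u w : V) (hw : w ∉ T)
    (hsink : IsSinkInto arcs w T) (hT : OutCoinsTailsIn arcs w T)
    (hP₁ : 0 < prob p (avoidEvent (arcsOff arcs (insert w T)) s T))
    (hP₂ : 0 < prob p (avoidEvent (arcsOff arcs (insert w T)) s (insert w T)))
    (hP₃ : 0 < prob p (avoidEvent (arcsOff arcs (insert w T)) s (insert u (insert w T)))) :
    DARC p arcs s T a b u w :=
  have hS₀ := sameEnds_arcsOff hS (insert w T)
  darc_of_sink p hp arcs s T a b u w hw hsink hT hP₁ hP₂ hP₃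
    (covC_nonneg p hp hS₀ s a b T)
    (covC_nonneg p hp hS₀ s a b (insert u (insert w T)))
    (shift_avoid_more_C p hp hS₀ s a (Finset.subset_insert w T))
    (shift_avoid_more_C p hp hS₀ s a (Finset.subset_insert u (insert w T)))
    (shift_avoid_more_C p hp hS₀ s b (Finset.subset_insert w T))
    (shift_avoid_more_C p hp hS₀ s b (Finset.subset_insert u (insert w T)))

/-- **THEOREM (pendant forward closure, mixed coin systems).** If the forward closure `Z' ∋ w` of
the head is closed out into `T`, entered only at `w`, and `s, a, b ∉ Z' ∪ T`, then
`DARC p arcs s T a b u w` holds for every `u` on every `SameEnds` (mixed) coin system, given the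
non-degeneracy of the three reduced avoidance events. -/
theorem darc_of_pendant_mixed (p : E → R) (hp : IsProbVec p) {arcs : E → Finset (V × V)}
    (hS : SameEnds arcs) (s : V) (T : Finset V) (a b u w : V) (Z' : Finset V) (hw : w ∈ Z')
    (hs : s ∉ Z') (ha : a ∉ Z' ∪ T) (hb : b ∉ Z' ∪ T) (hclosed : ClosedOut arcs Z' T)
    (hentry : EntryOnly arcs Z' w) (hT : TailCoinsIn arcs Z' T)
    (hP₁ : 0 < prob p (avoidEvent (arcsOff arcs (Z' ∪ T)) s T))
    (hP₂ : 0 < prob p (avoidEvent (arcsOff arcs (Z' ∪ T)) s (insert w T)))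
    (hP₃ : 0 < prob p (avoidEvent (arcsOff arcs (Z' ∪ T)) s (insert u (insert w T)))) :
    DARC p arcs s T a b u w :=
  have hS₀ := sameEnds_arcsOff hS (Z' ∪ T)
  darc_of_pendant p hp arcs s T a b u w Z' hw hs ha hb hclosed hentry hT hP₁ hP₂ hP₃
    (covC_nonneg p hp hS₀ s a b T)
    (covC_nonneg p hp hS₀ s a b (insert u (insert w T)))
    (shift_avoid_more_C p hp hS₀ s a (Finset.subset_insert w T))
    (shift_avoid_more_C p hp hS₀ s a (Finset.subset_insert u (insert w T)))
    (shift_avoid_more_C p hp hS₀ s b (Finset.subset_insert w T))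
    (shift_avoid_more_C p hp hS₀ s b (Finset.subset_insert u (insert w T)))

/-- **THEOREM (pendant path `w → v → t`, arbitrary entries, mixed coin systems).** Path coins
`c₁ = {w → v}`, `c₂ = {v → t}` (`t ∈ T`), the only coins leaving `w` or `v`; `a, b ∉ {w, v} ∪ T`.
Then `DARC p arcs s T a b u w` holds for every `u` on every `SameEnds` (mixed) coin system, given
the non-degeneracy of the path coins and of the four reduced avoidance events — the chain lemma
(Chebyshev) absorbing the pivotal branch's weight deficit. -/
theorem darc_of_path_mixed (p : E → R) (hp : IsProbVec p) {arcs : E → Finset (V × V)}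
    (hS : SameEnds arcs) (s : V) (T : Finset V) (a b u w v t : V) (c₁ c₂ : E)
    (hc₁ : arcs c₁ = {(w, v)}) (hc₂ : arcs c₂ = {(v, t)}) (hne : c₁ ≠ c₂) (hwv : w ≠ v)
    (htT : t ∈ T) (hwT : w ∉ T) (hvT : v ∉ T) (hpath : OnlyPathCoins arcs w v c₁ c₂)
    (ha : a ∉ ({w, v} : Finset V) ∪ T) (hb : b ∉ ({w, v} : Finset V) ∪ T)
    (hL₂pos : 0 < prob p (openEdge c₂ ∩ openEdge c₁))
    (hP₀ : 0 < prob p (avoidEvent (arcsOff arcs ({w, v} ∪ T)) s T))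
    (hP₁ : 0 < prob p (avoidEvent (arcsOff arcs ({w, v} ∪ T)) s (insert v T)))
    (hP₂ : 0 < prob p (avoidEvent (arcsOff arcs ({w, v} ∪ T)) s (insert w (insert v T))))
    (hP₃ : 0 < prob p (avoidEvent (arcsOff arcs ({w, v} ∪ T)) s
      (insert u (insert w (insert v T))))) :
    DARC p arcs s T a b u w :=
  have hS₀ := sameEnds_arcsOff hS ({w, v} ∪ T)
  darc_of_path p hp arcs s T a b u w v t c₁ c₂ hc₁ hc₂ hne hwv htT hwT hvT hpath ha hb hL₂pos
    hP₀ hP₁ hP₂ hP₃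
    (covC_nonneg p hp hS₀ s a b T)
    (covC_nonneg p hp hS₀ s a b (insert v T))
    (covC_nonneg p hp hS₀ s a b (insert u (insert w (insert v T))))
    (shift_avoid_more_C p hp hS₀ s a (Finset.subset_insert v T))
    (shift_avoid_more_C p hp hS₀ s a (Finset.subset_insert w (insert v T)))
    (shift_avoid_more_C p hp hS₀ s a (Finset.subset_insert u (insert w (insert v T))))
    (shift_avoid_more_C p hp hS₀ s b (Finset.subset_insert v T))
    (shift_avoid_more_C p hp hS₀ s b (Finset.subset_insert w (insert v T)))
    (shift_avoid_more_C p hp hS₀ s b (Finset.subset_insert u (insert w (insert v T))))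

end Unconditional

end Summit.Ventures.PercRepro2.Coin
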